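import Summits.AtomisticToContinuum.HydrodynamicLimit.Theses.InformationPercolationEngine

/-!
# `KickFairRelEquilibriumMeso` — window algebra (negative-lane helpers of the disprover, crux
stmt-AtomisticToContinuum-15177, route InformationPercolationEngine)

The rev-12 crux is `∃ rs : ℕ → ℝ, (∀ N, 0 < rs N) ∧ rs → 0 ∧ (N+1)·(rs N)³ → ∞ ∧ Body rs`, where
`Body rs` is the rev-4 body of `KickFairRelEquilibrium` read at the `N`-dependent mesh `rs N`
(`Torus.coarseCell (rs N)`): `E_{LG}|S_h| ≤ δ` eventually in `N`, uniformly over measurable weights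
`|h| ≤ 1` of the typed coarse past, `S_h = (ε/(N+1)) Σ_i Σ_{n<cnt_i} h(P_{i,n})(g(X_{i,n}) − κ_{i,n})`,
`κ = E_G[g(X) | σ(P)]` under the INVARIANT law. This file is the disprover's LOAD-BEARING ANALYSIS of
the three window conjuncts, as theorems (refuter-cdisprove-stmt-AtomisticToContinuum-15177-0,
2026-08-16); nothing here asserts a route statement positively.

* `kickFairRelEquilibriumMeso_iff` — the crux with its `let`-chain packaged into `kickSumRel` /
  `KickBoundRel` / `MesoBody` DEFINITIONALLY (`Iff.rfl`): the rev-12 change is `r ↦ rs N` and the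
  `∃ rs`-prefix, nothing else (`kickSumRel`/`KickBoundRel` are the verbatim `r`-parametrised
  `let`-chain, textually identical to the 14914 negative file's).
* `mesoBody_congr` — `Body` only reads the TAIL of the sequence (`rs =ᶠ rs' ⇒ (Body rs ↔ Body rs')`):
  the `∃ N₀ ∀ N ≥ N₀` absorbs finitely many cells of any size.
* `eventually_pos_of_lowerEdge`, `kickFairRelEquilibriumMeso_iff_dropPos` — the conjunct
  `∀ N, 0 < rs N` is NOT load-bearing: `(N+1)(rs N)³ → +∞` forces `0 < rs N` eventually, and the
  crux is EQUIVALENT to its version without the positivity conjunct.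
* `tendsto_hsDiameter_div_iff` — at every fixed `σ > 0` the lower edge `(N+1)(rs N)³ → ∞` is
  EXACTLY `ε_N / rs N → 0` (`ε_N = σ(N+1)^{-1/3}`): its whole content is "cells are infinitely
  coarser than a diameter" (no geometric pinning of an impact vector by the coarse positions; the
  equilibrium kernel given the past stays flux-diffuse). Since the mean free path is
  `ℓ_N = ε_N/(πσ³)`, the same edge gives `ℓ_N / rs N → 0` (`tendsto_freePath_div`): flights become
  intra-cell, so every LG/G discrepancy on file given the past that is a boundary-layer effect
  (`O(ℓ/rs)`, `O(ε/rs)`) dies along EVERY admissible sequence, as do the fixed-`r` mechanisms of the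
  lineage (`SubcellClusteringBiasPersists`: defect `∝ (rs N)²|∇log ρ|² → 0` by `rs → 0`).
* `not_kickFairRelEquilibriumMeso_iff` — THE SHAPE OF ANY KILL: `¬` the crux iff EVERY admissible
  sequence keeps a defect. A refutation (or a negative lemma modulo `H`) must therefore name a
  kick-law defect surviving `rs → 0` AND `ε/rs → 0` simultaneously — an `rs`-independent gap between
  the evolved and the equilibrium conditional kick laws, or non-summable centred-kick correlations
  under the invariant law. None is on file (the disprover's census: sub-cell clustering `∝ rs²`,
  first-order gradients `O(ε|∇|)`, Knudsen corrections `O(ℓ|∇|)`, boundary layers `O(ℓ/rs)` all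
  vanish; sub-cell hydrodynamic modes give a speed-`N` large-deviation LOWER bound that bites
  super-exponential STUBS, not the decl; the only untested regimes are post-shock horizons — the crux
  has `∀ τ` with no pre-shock restriction while its consumer `ChaosClosesEuler` lives on `[0, T)` —
  and packing/implosion, both without a mechanism in print).
-/

open MeasureTheory Metric Real Set Filter
open scoped InnerProductSpace ENNReal BigOperators Classical Topology

namespace Summit.AtomisticToContinuum.HydrodynamicLimit.Theorems.KickFairRelEquilibriumMesoNegative

noncomputable section

open Literature.MathematicalPhysics.KineticTheory (T3 V3 hsDiameter localGibbsLaw)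
open Literature.Analysis.FluidPDE (HardSphereFlow Config collisionTimesOf flightStart Geometry)
open Summit.AtomisticToContinuum.HydrodynamicLimit.Theses.InformationPercolationEngine
  (KickFairRelEquilibriumMeso)
/-- The 13478 typed past: cells and exact velocities of all spheres at the two flight starts, and
the partner label (same TYPE at every mesh; identical to `KickIsotropyInfoNegative.Past`, inlined to
keep this file's imports to the route file alone). -/
abbrev Past (N : ℕ) : Type :=
  ((Fin (N + 1) → (Fin 3 → ℤ) × V3) × (Fin (N + 1) → (Fin 3 → ℤ) × V3)) × Fin (N + 1)

/-- The flow type of the crux at reduced density `σ` and size `N + 1` (identical to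
`KickIsotropyInfoNegative.Flow`). -/
abbrev Flow (σ : ℝ) (N : ℕ) : Type :=
  HardSphereFlow (Literature.Analysis.FluidPDE.Torus.geometry (Fin 3)) (hsDiameter σ N) (N + 1)

/-! ## §1 The crux, repackaged (definitionally) -/

/-- The typed coarse past: cells and exact velocities of all spheres at the two flight starts,
partner label, the three times `(s_i, s_q, t_{i,n})` (same TYPE at every mesh). -/
abbrev PastRel (N : ℕ) : Type := Past N × (ℝ × ℝ × ℝ)

/-- The compensated (equilibrium-centred) kick sum `S_h` at mesh `r` — the crux's `let`-chain
verbatim with `rs N` abstracted to `r` (textually the 14914 `kickSumRel`). -/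
def kickSumRel (σ : ℝ) (N : ℕ) (Φ : Flow σ N) (τ r : ℝ) (g : V3 × V3 × V3 → ℝ)
    (h : Fin (N + 1) → ℕ → PastRel N → ℝ) (z : Config (N + 1) (Fin 3) T3) : ℝ :=
  let ε := hsDiameter σ N
  let G : Geometry (Fin 3) T3 := Literature.Analysis.FluidPDE.Torus.geometry (Fin 3)
  let q : T3 → (Fin 3 → ℤ) := Literature.Analysis.FluidPDE.Torus.coarseCell r
  let γ : Config (N + 1) (Fin 3) T3 → ℝ → Config (N + 1) (Fin 3) T3 := fun z s => Φ.flow s z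
  let cnt : Config (N + 1) (Fin 3) T3 → Fin (N + 1) → ℕ := fun z i =>
    Set.ncard (collisionTimesOf G ε (γ z) i ∩ Set.Ioc 0 τ)
  let P : Config (N + 1) (Fin 3) T3 → Fin (N + 1) → ℕ →
      (((Fin (N + 1) → (Fin 3 → ℤ) × V3) × (Fin (N + 1) → (Fin 3 → ℤ) × V3)) × Fin (N + 1)) ×
        (ℝ × ℝ × ℝ) := fun z i n =>
    if z ∈ Φ.good then
      ((Φ.coarsePastOf q i n z, Φ.nthPartnerOf i n z),
        (flightStart G ε (γ z) 0 i (Φ.nthCollisionTimeOf i n z),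
          flightStart G ε (γ z) 0 (Φ.nthPartnerOf i n z) (Φ.nthCollisionTimeOf i n z),
          Φ.nthCollisionTimeOf i n z))
    else (((fun _ => (0, 0), fun _ => (0, 0)), 0), (0, 0, 0))
  let X : Fin (N + 1) → ℕ → Config (N + 1) (Fin 3) T3 → V3 × V3 × V3 := fun i n z =>
    if z ∈ Φ.good then ((Φ.nthRecordOf i n z).impactVec, (Φ.nthRecordOf i n z).preVel) else 0
  let κ : Fin (N + 1) → ℕ → Config (N + 1) (Fin 3) T3 → ℝ := fun i n =>
    MeasureTheory.condExp (MeasurableSpace.comap (fun z => P z i n) inferInstance)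
      (localGibbsLaw σ (fun _ => 1) (fun _ => 0) (fun _ => 1) N Φ) (fun z => g (X i n z))
  ε / (N + 1 : ℝ) * ∑ i : Fin (N + 1), ∑ n ∈ Finset.range (cnt z i),
    h i n (P z i n) * (g (X i n z) - κ i n z)

/-- The conclusion of the crux for given data at mesh `r`: `‖S_h‖_{L¹(local Gibbs law)} ≤ δ`. -/
def KickBoundRel (σ : ℝ) (a₀ θ₀ : T3 → ℝ) (u₀ : T3 → V3) (N : ℕ) (Φ : Flow σ N) (τ r : ℝ)
    (g : V3 × V3 × V3 → ℝ) (h : Fin (N + 1) → ℕ → PastRel N → ℝ) (δ : ℝ) : Prop :=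
  ∫⁻ z, ENNReal.ofReal |kickSumRel σ N Φ τ r g h z| ∂(localGibbsLaw σ a₀ u₀ θ₀ N Φ) ≤
    ENNReal.ofReal δ

/-- **The body of the crux along a cell sequence `rs`** (everything after the three window
conjuncts): for continuous positive profiles, `∃ σ₀ ∀ σ < σ₀ ∀ Φ ∀ τ ∀ g ∀ δ ∃ N₀ ∀ N ≥ N₀ ∀ h`,
`KickBoundRel … (rs N) …`. -/
def MesoBody (rs : ℕ → ℝ) : Prop :=
  ∀ (a₀ θ₀ : T3 → ℝ) (u₀ : T3 → V3), Continuous a₀ → Continuous θ₀ → Continuous u₀ →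
    (∀ x, 0 < a₀ x) → (∀ x, 0 < θ₀ x) → ∃ σ₀ : ℝ, 0 < σ₀ ∧ ∀ σ : ℝ, 0 < σ → σ < σ₀ →
    ∀ Φ : (N : ℕ) → Flow σ N, ∀ τ : ℝ, 0 < τ →
    ∀ g : V3 × V3 × V3 → ℝ, Continuous g → (∃ C : ℝ, ∀ p, |g p| ≤ C) →
    ∀ δ : ℝ, 0 < δ → ∃ N₀ : ℕ, ∀ N : ℕ, N₀ ≤ N →
    ∀ h : Fin (N + 1) → ℕ → PastRel N → ℝ, (∀ i n, Measurable (h i n)) →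
    (∀ i n p, |h i n p| ≤ 1) → KickBoundRel σ a₀ θ₀ u₀ N (Φ N) τ (rs N) g h δ

/-- **The lower window edge** `(N+1)·(rs N)³ → +∞` (particles per cell diverge). -/
def LowerEdge (rs : ℕ → ℝ) : Prop :=
  Tendsto (fun N : ℕ => ((N : ℝ) + 1) * rs N ^ 3) atTop atTop

/-- **Faithful restatement of the crux** (definitional unfolding): window conjuncts, then
`MesoBody`. -/
theorem kickFairRelEquilibriumMeso_iff :
    KickFairRelEquilibriumMeso ↔
      ∃ rs : ℕ → ℝ, (∀ N, 0 < rs N) ∧ Tendsto rs atTop (𝓝 0) ∧ LowerEdge rs ∧ MesoBody rs :=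
  Iff.rfl

/-! ## §2 Only the tail of the sequence is read -/

/-- **`MesoBody` depends on the cell sequence only through its tail**: sequences that eventually
agree have the same body (the `∃ N₀ ∀ N ≥ N₀` absorbs any finite prefix). [folklore] -/
theorem mesoBody_congr {rs rs' : ℕ → ℝ} (heq : rs =ᶠ[atTop] rs') : MesoBody rs ↔ MesoBody rs' := by
  -- symmetric argument, done once
  suffices key : ∀ {a b : ℕ → ℝ}, a =ᶠ[atTop] b → MesoBody a → MesoBody b from
    ⟨key heq, key heq.symm⟩
  intro a b hab hA a₀ θ₀ u₀ ha hθ hu ha0 hθ0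
  obtain ⟨σ₀, hσ₀, H⟩ := hA a₀ θ₀ u₀ ha hθ hu ha0 hθ0
  refine ⟨σ₀, hσ₀, fun σ hσ hσσ₀ Φ τ hτ g hg hgb δ hδ => ?_⟩
  obtain ⟨N₀, hN₀⟩ := H σ hσ hσσ₀ Φ τ hτ g hg hgb δ hδ
  obtain ⟨N₁, hN₁⟩ := eventually_atTop.1 hab
  refine ⟨max N₀ N₁, fun N hN h hhm hhb => ?_⟩
  have h1 : a N = b N := hN₁ N (le_of_max_le_right hN)
  rw [← h1]
  exact hN₀ N (le_of_max_le_left hN) h hhm hhb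

/-! ## §3 The positivity conjunct is not load-bearing -/

/-- **The lower edge forces positivity eventually**: `(N+1)(rs N)³ → +∞ ⇒ 0 < rs N` for all large
`N` (a cube is positive iff its base is). [folklore] -/
theorem eventually_pos_of_lowerEdge {rs : ℕ → ℝ} (h3 : LowerEdge rs) : ∀ᶠ N in atTop, 0 < rs N := by
  filter_upwards [h3.eventually_gt_atTop 0] with N hN
  have h1 : (0 : ℝ) < (N : ℝ) + 1 := by positivity
  have h2 : 0 < rs N ^ 3 := by
    by_contra hle
    push Not at hle
    have := mul_nonpos_of_nonneg_of_nonpos h1.le hle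
    linarith
  exact (Odd.pow_pos_iff (by decide : Odd 3)).1 h2

/-- **The crux is equivalent to its version WITHOUT `∀ N, 0 < rs N`.** Given a sequence with the
two limit conjuncts and the body, replace its (finitely many) non-positive cells by `1`: the limits
and — by `mesoBody_congr` — the body are unchanged. So a prover may ignore positivity and a
refuter gains nothing from it. [folklore] -/
theorem kickFairRelEquilibriumMeso_iff_dropPos :
    KickFairRelEquilibriumMeso ↔
      ∃ rs : ℕ → ℝ, Tendsto rs atTop (𝓝 0) ∧ LowerEdge rs ∧ MesoBody rs := by
  rw [kickFairRelEquilibriumMeso_iff]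
  constructor
  · rintro ⟨rs, -, h0, h3, hB⟩
    exact ⟨rs, h0, h3, hB⟩
  · rintro ⟨rs, h0, h3, hB⟩
    set rs' : ℕ → ℝ := fun N => if 0 < rs N then rs N else 1 with hrs'
    have heq : rs =ᶠ[atTop] rs' := by
      filter_upwards [eventually_pos_of_lowerEdge h3] with N hN
      simp [hrs', hN]
    refine ⟨rs', fun N => ?_, h0.congr' heq, ?_, (mesoBody_congr heq).1 hB⟩
    · simp only [hrs']
      split_ifs with h
      · exact h
      · exact one_pos
    · refine Tendsto.congr' ?_ h3
      filter_upwards [heq] with N hN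
      rw [hN]

/-! ## §4 What the lower edge says, exactly: `ε ≪ rs` (and hence `ℓ ≪ rs`) -/

/-- The algebra of the reduced diameter against a mesh: `ε_N / r = σ · ((N+1) r³)^{-1/3}` for
`r > 0`. [folklore] -/
theorem hsDiameter_div_eq (σ : ℝ) (N : ℕ) {r : ℝ} (hr : 0 < r) :
    hsDiameter σ N / r = σ * (((N : ℝ) + 1) * r ^ 3) ^ (-(1 / 3 : ℝ)) := by
  have hN : (0 : ℝ) < (N : ℝ) + 1 := by positivity
  unfold hsDiameter
  rw [Real.mul_rpow hN.le (pow_nonneg hr.le 3), Real.rpow_neg hN.le, Real.rpow_neg (pow_nonneg hr.le 3),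
    show (r ^ 3 : ℝ) = r ^ (3 : ℝ) by norm_cast, ← Real.rpow_mul hr.le]
  norm_num
  rw [Real.rpow_neg hN.le]
  field_simp

/-- **Lower edge ⇒ no geometric pinning**: along a positive sequence with `(N+1)(rs N)³ → ∞`,
`ε_N / rs N → 0` at every `σ` — the cells become infinitely coarser than a diameter. [folklore] -/
theorem tendsto_hsDiameter_div {rs : ℕ → ℝ} (σ : ℝ) (hpos : ∀ N, 0 < rs N) (h3 : LowerEdge rs) :
    Tendsto (fun N : ℕ => hsDiameter σ N / rs N) atTop (𝓝 0) := by
  simp_rw [fun N => hsDiameter_div_eq σ N (hpos N)]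
  rw [show (0 : ℝ) = σ * 0 by ring]
  exact ((tendsto_rpow_neg_atTop (by norm_num : (0 : ℝ) < 1 / 3)).comp h3).const_mul σ

/-- **Conversely, `ε_N / rs N → 0` at one `σ > 0` gives back the lower edge**: the third window
conjunct carries no information beyond "`ε ≪ rs`". [folklore] -/
theorem lowerEdge_of_tendsto_hsDiameter_div {rs : ℕ → ℝ} {σ : ℝ} (hσ : 0 < σ) (hpos : ∀ N, 0 < rs N)
    (h : Tendsto (fun N : ℕ => hsDiameter σ N / rs N) atTop (𝓝 0)) : LowerEdge rs := by
  -- y_N := (N+1) rs³ > 0 and σ y_N^{-1/3} → 0, so y_N^{-1/3} → 0⁺, so y_N = (y_N^{-1/3})^{-3} → ∞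
  have hy : ∀ N : ℕ, 0 < ((N : ℝ) + 1) * rs N ^ 3 := fun N =>
    mul_pos (by positivity) (pow_pos (hpos N) 3)
  have h1 : Tendsto (fun N : ℕ => (((N : ℝ) + 1) * rs N ^ 3) ^ (-(1 / 3 : ℝ))) atTop (𝓝 0) := by
    have h' : Tendsto (fun N : ℕ => σ⁻¹ * (hsDiameter σ N / rs N)) atTop (𝓝 (σ⁻¹ * 0)) :=
      h.const_mul σ⁻¹
    rw [mul_zero] at h'
    refine h'.congr fun N => ?_
    rw [hsDiameter_div_eq σ N (hpos N), ← mul_assoc, inv_mul_cancel₀ hσ.ne', one_mul]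
  have h2 : Tendsto (fun N : ℕ => (((N : ℝ) + 1) * rs N ^ 3) ^ (-(1 / 3 : ℝ))) atTop (𝓝[>] 0) := by
    refine tendsto_nhdsWithin_iff.2 ⟨h1, Eventually.of_forall fun N => ?_⟩
    exact Real.rpow_pos_of_pos (hy N) _
  have h3 : Tendsto (fun x : ℝ => x ^ (-(3 : ℝ))) (𝓝[>] 0) atTop := tendsto_rpow_neg_nhdsGT_zero (by norm_num)
  refine (h3.comp h2).congr fun N => ?_
  simp only [Function.comp]
  rw [← Real.rpow_mul (hy N).le]
  norm_num

/-- **The lower edge, as an equivalence** (`σ > 0`, positive cells): `(N+1)(rs N)³ → ∞ ⟺ ε_N/rs N → 0`.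
[folklore] -/
theorem lowerEdge_iff_tendsto_hsDiameter_div {rs : ℕ → ℝ} {σ : ℝ} (hσ : 0 < σ) (hpos : ∀ N, 0 < rs N) :
    LowerEdge rs ↔ Tendsto (fun N : ℕ => hsDiameter σ N / rs N) atTop (𝓝 0) :=
  ⟨tendsto_hsDiameter_div σ hpos, lowerEdge_of_tendsto_hsDiameter_div hσ hpos⟩

/-- The mean free path at unit number density: `ℓ_N = 1/(π (N+1) ε_N²) = ε_N/(π σ³)`
(Boltzmann–Enskog free path without the contact-value factor). -/
def freePath (σ : ℝ) (N : ℕ) : ℝ := hsDiameter σ N / (Real.pi * σ ^ 3)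

/-- **Lower edge ⇒ flights are intra-cell**: `ℓ_N / rs N → 0` along every admissible sequence at
every `σ > 0` — the boundary-layer discrepancies `O(ℓ/rs)` of the lineage die in the window.
[folklore] -/
theorem tendsto_freePath_div {rs : ℕ → ℝ} {σ : ℝ} (hpos : ∀ N, 0 < rs N) (h3 : LowerEdge rs) :
    Tendsto (fun N : ℕ => freePath σ N / rs N) atTop (𝓝 0) := by
  have key : ∀ N : ℕ, freePath σ N / rs N = (Real.pi * σ ^ 3)⁻¹ * (hsDiameter σ N / rs N) := by
    intro N
    unfold freePath
    rw [div_div, mul_comm (Real.pi * σ ^ 3) (rs N), ← div_div, div_eq_inv_mul _ (Real.pi * σ ^ 3)]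
  simp_rw [key]
  rw [show (0 : ℝ) = (Real.pi * σ ^ 3)⁻¹ * 0 by ring]
  exact (tendsto_hsDiameter_div σ hpos h3).const_mul _

/-! ## §5 The shape of any kill -/

/-- **`¬ KickFairRelEquilibriumMeso` iff EVERY admissible sequence keeps a defect.** A refutation, or
a negative lemma modulo `H`, must therefore name a kick-law defect that survives `rs → 0` together
with `ε/rs → 0` (equivalently `ℓ/rs → 0`): scale artefacts of one mesh no longer refute. [folklore] -/
theorem not_kickFairRelEquilibriumMeso_iff :
    ¬ KickFairRelEquilibriumMeso ↔
      ∀ rs : ℕ → ℝ, (∀ N, 0 < rs N) → Tendsto rs atTop (𝓝 0) → LowerEdge rs → ¬ MesoBody rs := by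
  rw [kickFairRelEquilibriumMeso_iff]
  simp only [not_exists, not_and]

/-- **Equivalently (positivity dropped)**: every sequence with `rs → 0` and `ε/rs → 0` keeps a
defect. [folklore] -/
theorem not_kickFairRelEquilibriumMeso_iff' :
    ¬ KickFairRelEquilibriumMeso ↔
      ∀ rs : ℕ → ℝ, Tendsto rs atTop (𝓝 0) → LowerEdge rs → ¬ MesoBody rs := by
  rw [kickFairRelEquilibriumMeso_iff_dropPos]
  simp only [not_exists, not_and]

end

end Summit.AtomisticToContinuum.HydrodynamicLimit.Theorems.KickFairRelEquilibriumMesoNegative
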